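import Summits.Ventures.PercRepro.C025ProfileOneFlat

/-!
# THE LEVEL PROFILE OF EVERY MATROID IS MONOTONE, AND THE SECOND ROW ON `T_r(M₁ ⊕ U_{m,m})` FOR EVERY `M₁` (night-3 g24)

`proofs/NIGHT3-G24-ONEFLAT.md` §4(e)–§5.  For a finite matroid `M₁` of rank `s` with level counts `W c = #{Y ⊆ E₁ : ρ₁(Y) = c}`:

  `(s − c) · W c ≤ (c + 1) · W (c+1)`        (`level_profile_step`)

— count the pairs `(Y, e)` with `ρ₁(Y) = c` and `e ∉ cl(Y)`: every `Y` has at least `s − c` such `e` (`ρ(E) ≤ ρ(cl Y) + |E ∖ cl Y|`),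
and `(Y, e) ↦ Y ∪ {e}` lands in the level `c+1` with fibres of size at most `c+1` (the fibre over `Y'` is the set of coloops of
`M₁|Y'`, an independent set).  Hence `W c / C(s,c)` is non-decreasing (`level_profile_mono`; census: all 383,172 matroid classes
on 9 elements, 0 failures, lab/profmono.c), which is exactly the hypothesis of `OneFlat.profileIneq_second_of_split`.  So the
second row `(q, r−1)` of (Π) holds on EVERY finite matroid `M` with `gr M = gr M₁ ⊔ E₂` and `ρ_M(X) = min(r, ρ₁(X ∩ E₁) + |X ∩ E₂|)`
— the truncation to rank `r` of `M₁ ⊕ U_{m,m}` for an arbitrary `M₁` — whenever `q + 2 ≤ r` and `r + q ≤ s + m`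
(`profileIneq_second_of_split_matroid`), and C-025 at `(r, r−2)` for `2r − 2 ≤ s + m` (`rls_of_split_matroid`).
* `card_filter_notMem_closure_ge` — `#{e ∈ E : e ∉ cl Y} ≥ s − ρ(Y)`;
* `card_filter_notMem_closure_erase_le` — the coloops of `M|Y'` number at most `ρ(Y')`;
* `level_profile_step`, `mono_of_adjacent`, `level_profile_mono`;
* **`profileIneq_second_of_split_matroid`**, **`rls_of_split_matroid`**.
No `def`, no `instance`, no notation.  Axioms: standard.
-/

open scoped Matroid

namespace PercRepro

open Finset ThmH

namespace OneFlat

variable {α : Type} [DecidableEq α]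

/-- From adjacent cross-ratios to all pairs: if `B c > 0` on `c ≤ s` and `A c · B (c+1) ≤ A (c+1) · B c` for `c < s`,
then `A c' · B c ≤ A c · B c'` for all `c' ≤ c ≤ s`. -/
theorem mono_of_adjacent (A B : ℕ → ℕ) (s : ℕ) (hB : ∀ c, c ≤ s → 0 < B c)
    (hadj : ∀ c, c < s → A c * B (c + 1) ≤ A (c + 1) * B c) :
    ∀ c' c, c' ≤ c → c ≤ s → A c' * B c ≤ A c * B c' := by
  intro c' c hc'c hcs
  induction c, hc'c using Nat.le_induction with
  | base => exact le_rfl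
  | succ c hc'c ih =>
    have ih' := ih (by omega)
    have h1 := hadj c (by omega)
    have hBc : 0 < B c := hB c (by omega)
    apply Nat.le_of_mul_le_mul_right (c := B c) _ hBc
    calc A c' * B (c + 1) * B c = (A c' * B c) * B (c + 1) := by ring
      _ ≤ (A c * B c') * B (c + 1) := Nat.mul_le_mul_right _ ih'
      _ = (A c * B (c + 1)) * B c' := by ring
      _ ≤ (A (c + 1) * B c) * B c' := Nat.mul_le_mul_right _ h1
      _ = A (c + 1) * B c' * B c := by ring

section Profile

variable (M : Matroid α) [M.Finite]

omit [DecidableEq α] in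
open Classical in
/-- A set of rank `c` in a matroid of rank `s` misses at least `s − c` points of the closure's complement:
`#{e ∈ E : e ∉ cl(Y)} ≥ s − c`. -/
theorem card_filter_notMem_closure_ge {s c : ℕ} (hs : M.eRank = (s : ℕ∞)) (Y : Finset α)
    (hY : M.eRk (Y : Set α) = (c : ℕ∞)) :
    s - c ≤ ((gr M).filter (fun e => e ∉ M.closure (Y : Set α))).card := by
  classical
  have hcoe : (((gr M).filter (fun e => e ∉ M.closure (Y : Set α)) : Finset α) : Set α) =
      M.E \ M.closure (Y : Set α) := by
    ext x
    simp only [coe_filter, Set.mem_setOf_eq, Set.mem_sdiff]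
    rw [← mem_coe, coe_gr]
  have hE : M.E = M.closure (Y : Set α) ∪ (M.E \ M.closure (Y : Set α)) :=
    (Set.union_sdiff_cancel (M.closure_subset_ground _)).symm
  have h1 : M.eRank ≤ M.eRk (M.closure (Y : Set α)) + M.eRk (M.E \ M.closure (Y : Set α)) := by
    rw [Matroid.eRank_def]
    conv_lhs => rw [hE]
    exact M.eRk_union_le_eRk_add_eRk _ _
  rw [M.eRk_closure_eq, hY, hs] at h1
  have h2 : M.eRk (M.E \ M.closure (Y : Set α)) ≤ (((gr M).filter (fun e => e ∉ M.closure (Y : Set α))).card : ℕ∞) := by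
    rw [← hcoe, ← Set.encard_coe_eq_coe_finsetCard]
    exact M.eRk_le_encard _
  have h3 : (s : ℕ∞) ≤ (c : ℕ∞) + (((gr M).filter (fun e => e ∉ M.closure (Y : Set α))).card : ℕ∞) :=
    h1.trans (add_le_add le_rfl h2)
  have h4 : s ≤ c + ((gr M).filter (fun e => e ∉ M.closure (Y : Set α))).card := by exact_mod_cast h3
  omega

open Classical in
/-- The points of `Y'` outside the closure of the rest (the coloops of `M|Y'`) form an independent set, so number at most
`ρ(Y')`. -/
theorem card_filter_notMem_closure_erase_le {c : ℕ} (Y' : Finset α) (hY' : Y' ⊆ gr M)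
    (hc : M.eRk (Y' : Set α) = (c : ℕ∞)) :
    (Y'.filter (fun e => e ∉ M.closure ((Y'.erase e : Finset α) : Set α))).card ≤ c := by
  classical
  set C := Y'.filter (fun e => e ∉ M.closure ((Y'.erase e : Finset α) : Set α)) with hC
  have hCY : (C : Set α) ⊆ (Y' : Set α) := by
    intro x hx
    simp only [hC, coe_filter, Set.mem_setOf_eq] at hx
    exact hx.1
  have hCE : (C : Set α) ⊆ M.E := hCY.trans (by rw [← coe_gr]; exact_mod_cast hY')
  have hind : M.Indep (C : Set α) := by
    rw [Matroid.indep_iff_forall_notMem_closure_sdiff hCE]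
    intro e he
    have he' := he
    simp only [hC, coe_filter, Set.mem_setOf_eq] at he'
    intro hmem
    apply he'.2
    have hsub : (C : Set α) \ {e} ⊆ ((Y'.erase e : Finset α) : Set α) := by
      intro x hx
      simp only [Set.mem_sdiff, Set.mem_singleton_iff] at hx
      rw [mem_coe, mem_erase]
      exact ⟨hx.2, hCY hx.1⟩
    exact M.closure_subset_closure hsub hmem
  have h1 := hind.encard_le_eRk_of_subset hCY
  rw [hc, Set.encard_coe_eq_coe_finsetCard] at h1
  exact_mod_cast h1

/-- **THE LEVEL PROFILE OF A MATROID IS MONOTONE**: `(s − c) · #{Y : ρ(Y) = c} ≤ (c + 1) · #{Y : ρ(Y) = c + 1}`. -/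
theorem level_profile_step {s : ℕ} (hs : M.eRank = (s : ℕ∞)) (c : ℕ) :
    (s - c) * (Shadow.levelSet M c).card ≤ (c + 1) * (Shadow.levelSet M (c + 1)).card := by
  classical
  -- the pairs `(Y, e)` with `ρ(Y) = c`, `e ∈ E ∖ cl(Y)`
  set P : Finset (Finset α × α) :=
    (Shadow.levelSet M c ×ˢ gr M).filter (fun Ye => Ye.2 ∉ M.closure ((Ye.1 : Finset α) : Set α)) with hP
  -- (1) `#P ≥ (s − c) · #L_c`
  have hmaps : Set.MapsTo (fun Ye : Finset α × α => Ye.1) ↑P ↑(Shadow.levelSet M c) := by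
    intro Ye hYe
    simp only [hP, coe_filter, Set.mem_setOf_eq, mem_product] at hYe
    exact hYe.1.1
  have h1 : (s - c) * (Shadow.levelSet M c).card ≤ P.card := by
    rw [card_eq_sum_card_fiberwise hmaps]
    calc (s - c) * (Shadow.levelSet M c).card = ∑ Y ∈ Shadow.levelSet M c, (s - c) := by
          rw [sum_const, smul_eq_mul, mul_comm]
      _ ≤ ∑ Y ∈ Shadow.levelSet M c, (P.filter (fun Ye => Ye.1 = Y)).card := ?_
    apply sum_le_sum
    intro Y hY
    rw [Profile.mem_levelSet] at hY
    have hfib : ((gr M).filter (fun e => e ∉ M.closure (Y : Set α))).card =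
        (P.filter (fun Ye => Ye.1 = Y)).card := by
      apply card_bij (fun e _ => (Y, e))
      · intro e he
        simp only [mem_filter] at he
        simp only [hP, mem_filter, mem_product, Profile.mem_levelSet, and_true]
        exact ⟨⟨⟨hY.1, hY.2⟩, he.1⟩, he.2⟩
      · intro e _ e' _ h
        simp only [Prod.mk.injEq] at h
        exact h.2
      · intro Ye hYe
        simp only [hP, mem_filter, mem_product] at hYe
        refine ⟨Ye.2, ?_, ?_⟩
        · simp only [mem_filter]
          refine ⟨hYe.1.1.2, ?_⟩
          rw [← hYe.2]; exact hYe.1.2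
        · rw [← hYe.2]
    rw [← hfib]
    exact card_filter_notMem_closure_ge M hs Y hY.2
  -- (2) `#P ≤ (c + 1) · #L_{c+1}` through `(Y, e) ↦ Y ∪ {e}`
  have himage : P.image (fun Ye : Finset α × α => insert Ye.2 Ye.1) ⊆ Shadow.levelSet M (c + 1) := by
    intro Y' hY'
    rw [mem_image] at hY'
    obtain ⟨⟨Y, e⟩, hYe, rfl⟩ := hY'
    simp only [hP, mem_filter, mem_product, Profile.mem_levelSet] at hYe
    rw [Profile.mem_levelSet]
    refine ⟨insert_subset hYe.1.2 hYe.1.1.1, ?_⟩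
    rw [coe_insert, Matroid.eRk_insert_eq_add_one ⟨by rw [← coe_gr]; exact_mod_cast hYe.1.2, hYe.2⟩, hYe.1.1.2]
    push_cast
    rfl
  have hfibre : ∀ Y' ∈ P.image (fun Ye : Finset α × α => insert Ye.2 Ye.1),
      (P.filter (fun Ye => insert Ye.2 Ye.1 = Y')).card ≤ c + 1 := by
    intro Y' hY'
    have hY'L := himage hY'
    rw [Profile.mem_levelSet] at hY'L
    have hle := card_filter_notMem_closure_erase_le M Y' hY'L.1 hY'L.2
    refine le_trans ?_ hle
    apply card_le_card_of_injOn (fun Ye : Finset α × α => Ye.2)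
    · intro Ye hYe
      simp only [coe_filter, Set.mem_setOf_eq, hP, mem_filter, mem_product, Profile.mem_levelSet] at hYe
      obtain ⟨⟨⟨⟨hYg, hYc⟩, heg⟩, hecl⟩, hins⟩ := hYe
      have heY : Ye.2 ∉ Ye.1 := by
        intro hmem
        exact hecl (M.subset_closure _ (by rw [← coe_gr]; exact_mod_cast hYg) (mem_coe.2 hmem))
      have hYerase : Y'.erase Ye.2 = Ye.1 := by
        rw [← hins, erase_insert heY]
      simp only [mem_coe, mem_filter]
      refine ⟨by rw [← hins]; exact mem_insert_self _ _, ?_⟩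
      rw [hYerase]
      exact hecl
    · intro Ye hYe Ye' hYe' h
      simp only [coe_filter, Set.mem_setOf_eq, hP, mem_filter, mem_product, Profile.mem_levelSet] at hYe hYe'
      simp only at h
      have heY : Ye.2 ∉ Ye.1 := fun hmem =>
        hYe.1.2 (M.subset_closure _ (by rw [← coe_gr]; exact_mod_cast hYe.1.1.1.1) (mem_coe.2 hmem))
      have heY' : Ye'.2 ∉ Ye'.1 := fun hmem =>
        hYe'.1.2 (M.subset_closure _ (by rw [← coe_gr]; exact_mod_cast hYe'.1.1.1.1) (mem_coe.2 hmem))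
      have h1 : Ye.1 = Y'.erase Ye.2 := by rw [← hYe.2, erase_insert heY]
      have h2 : Ye'.1 = Y'.erase Ye'.2 := by rw [← hYe'.2, erase_insert heY']
      rw [Prod.ext_iff]
      exact ⟨by rw [h1, h2, h], h⟩
  have h2 : P.card ≤ (c + 1) * (Shadow.levelSet M (c + 1)).card := by
    calc P.card ≤ (c + 1) * (P.image (fun Ye : Finset α × α => insert Ye.2 Ye.1)).card :=
          card_le_mul_card_image P (c + 1) hfibre
      _ ≤ (c + 1) * (Shadow.levelSet M (c + 1)).card := Nat.mul_le_mul_left _ (card_le_card himage)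
  exact h1.trans h2

/-- The cross-multiplied monotonicity of the level profile: `#L_{c'} · C(s,c) ≤ #L_c · C(s,c')` for `c' ≤ c ≤ s`. -/
theorem level_profile_mono {s : ℕ} (hs : M.eRank = (s : ℕ∞)) :
    ∀ c' c, c' ≤ c → c ≤ s → (Shadow.levelSet M c').card * s.choose c ≤ (Shadow.levelSet M c).card * s.choose c' := by
  apply mono_of_adjacent (fun c => (Shadow.levelSet M c).card) (fun c => s.choose c) s
  · intro c hc; exact Nat.choose_pos hc
  · intro c hc
    have h1 := level_profile_step M hs c
    have h2 := Nat.choose_succ_right_eq s c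
    apply Nat.le_of_mul_le_mul_right (c := c + 1) _ (by omega)
    calc (Shadow.levelSet M c).card * s.choose (c + 1) * (c + 1)
        = (Shadow.levelSet M c).card * (s.choose (c + 1) * (c + 1)) := by ring
      _ = (Shadow.levelSet M c).card * (s.choose c * (s - c)) := by rw [h2]
      _ = ((s - c) * (Shadow.levelSet M c).card) * s.choose c := by ring
      _ ≤ ((c + 1) * (Shadow.levelSet M (c + 1)).card) * s.choose c := Nat.mul_le_mul_right _ h1
      _ = (Shadow.levelSet M (c + 1)).card * s.choose c * (c + 1) := by ring

end Profile

section Split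

variable (M : Matroid α) [M.Finite] (M₁ : Matroid α) [M₁.Finite] (E₂ : Finset α) (r : ℕ)

/-- **THE SECOND ROW `(q, r−1)` OF (Π) ON `T_r(M₁ ⊕ U_{m,m})` FOR EVERY FINITE MATROID `M₁`** (rank `s`, ground `E₁ = gr M₁`):
`M` finite with `gr M = E₁ ⊔ E₂` and `ρ_M(X) = min(r, ρ_{M₁}(X ∩ E₁) + |X ∩ E₂|)`; for `q + 2 ≤ r` and `r + q ≤ s + |E₂|`. -/
theorem profileIneq_second_of_split_matroid (hE : gr M = gr M₁ ∪ E₂) (hdisj : Disjoint (gr M₁) E₂)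
    {s : ℕ} (hs : M₁.eRank = (s : ℕ∞))
    (hrk : ∀ X : Finset α, X ⊆ gr M →
      M.eRk (X : Set α) = ((min r ((M₁.eRk ((X ∩ gr M₁ : Finset α) : Set α)).toNat + (X ∩ E₂).card) : ℕ) : ℕ∞))
    (q : ℕ) (hq : q + 2 ≤ r) (hreg : r + q ≤ s + E₂.card) :
    Profile.ProfileIneq M q (r - 1) := by
  have hfin : ∀ Y : Finset α, M₁.eRk (Y : Set α) ≠ ⊤ := by
    intro Y
    exact ne_top_of_le_ne_top (M₁.eRank_ne_top_iff.2 inferInstance) (M₁.eRk_le_eRank _)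
  have hlevel : ∀ c, ((gr M₁).powerset.filter (fun Y : Finset α => (M₁.eRk (Y : Set α)).toNat = c)).card =
      (Shadow.levelSet M₁ c).card := by
    intro c
    congr 1
    apply filter_congr
    intro Y _
    constructor
    · intro h
      rw [← h, ENat.coe_toNat (hfin Y)]
    · intro h
      rw [h, ENat.toNat_coe]
  apply profileIneq_second_of_split M (gr M₁) E₂ (fun Y => (M₁.eRk (Y : Set α)).toNat) r hE hdisj s _ hrk _ q hq hreg
  · intro Y _
    have h := M₁.eRk_le_eRank (Y : Set α)
    rw [hs] at h
    have h' := ENat.toNat_le_toNat h (by simp)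
    simpa using h'
  · intro c' c hc'c hcs
    rw [hlevel c', hlevel c]
    exact level_profile_mono M₁ hs c' c hc'c hcs

/-- **C-025 AT `(r, r−2)` ON `T_r(M₁ ⊕ U_{m,m})` FOR EVERY FINITE MATROID `M₁`**, `2r − 2 ≤ s + m`. -/
theorem rls_of_split_matroid (hE : gr M = gr M₁ ∪ E₂) (hdisj : Disjoint (gr M₁) E₂)
    {s : ℕ} (hs : M₁.eRank = (s : ℕ∞))
    (hrk : ∀ X : Finset α, X ⊆ gr M →
      M.eRk (X : Set α) = ((min r ((M₁.eRk ((X ∩ gr M₁ : Finset α) : Set α)).toNat + (X ∩ E₂).card) : ℕ) : ℕ∞))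
    (hr : 2 ≤ r) (hreg : 2 * r ≤ s + E₂.card + 2) :
    ThmN.RLS M r (r - 2) := by
  apply GirthRows.rls_of_profileIneq_rows
  intro u hu1 hu2
  have hu : u = r - 1 := by omega
  subst hu
  exact profileIneq_second_of_split_matroid M M₁ E₂ r hE hdisj hs hrk (r - 2) (by omega) (by omega)

end Split

end OneFlat

end PercRepro
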